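import Literature.AlgebraicGeometry.Hironaka2017.S09LLUED.R057aHFlat
import Literature.AlgebraicGeometry.Hironaka2017.S09LLUED.R014MasterKey
import Literature.AlgebraicGeometry.Hironaka2017.Proofs.S09LLUED.Rem99c
import Literature.AlgebraicGeometry.Hironaka2017.Proofs.S09LLUED.Rem910c
import Literature.AlgebraicGeometry.Hironaka2017.Proofs.S09LLUED.Rem911c
import Summits.ResolutionOfSingularities.ResolutionOfSingularities.Theorems.MarkedTransferCampaignG1PnegaInterfaceV3
import HarnessLib

/-!
# [OURS · L1 G1 ℘nega-INTERFACE] Obligation **F3.3** — «§9.3 `⊟(g,a) ⊂ ℘̃`» — over the checklist of record `Campaign.PnegaInterfaceV3`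
# (p487629). Data-level kernel by res-type-063 (res-D-plan-1 ROUTING #8 (d) 2026-08-27T02:04:02Z; draft rev 2
# `D/res-type-063/PnegaObligationF33.draft.lean` sha16 40cc0d751fadf968, farm-clean; route engine = res-type-057's `Rem99c/Rem910c/Rem911c`),
# carried summit-side by the typer of record res-L1-type-o2: guard clauses ↦ the tree's `Campaign.IsCharFiltration K P` (same four
# conjuncts), + §6 `PnegaInterfaceV3.F33`; Lean terms otherwise byte-identical to the draft. res-D-plan-1 V3 RULING 01:55:32Z C1.

## 1. What the page consumes (locators read on `p0047.txt`, `p0051.txt`, `p0055.txt`, `p0058.txt` by res-type-063)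
p.47 L1–L2 «… selection of a subset ⊟(Ě) ⊂ ℘nega(Ě)», L7–L11 «To define ⊟(g,q) and have h ∈ ⊟(g,q) ⊂ ⊟(Ě) we need … differentiation-
product operations» (rows 014 `Boxminus`, `U47L8`); Th. 9.2 p.47 L20–L29 (row 014 `negaSum`, «ignoring their degrees»); §9.7 p.51: the
products ARE the three `H♭` formulas (Rem. 9.9 L3, 9.10 L12, 9.11 (7) L27; Def. 9.12 L30–L32; row 057 `HFlat.op`), each value PLACED in a
named piece «∈ ℘(Ě, −δ(…))» L7 / L15 / L29, «homogeneity degrees < 0» L31–L32 (row 057 `Rem9_9_2`, `Rem9_10_2`, `Rem9_11_8`, `U51_2`);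
Rem. 9.9 L10–L11 «g(0) = y^q + ϵ(0) ∈ ℘(Ě, q) and ∂(ϵ(0)) = ∂(g(0))» (row 057 `U51_1`) is the SOURCE of the crossing: `∂^{(α+pβ)}`,
`∂^{(qγ₀)}` act on an element of the POSITIVE piece `℘(E,q)` with orders that may exceed `q`, the value is placed in a NEGATIVE degree
— the F3 CROSSING INSTANCE res-adj-1's C1 split off the structure; p.49 L11–L12 / L17–L20 «u₀ is a unit in ρ^ℓ(O_ξ)», «∂(uX) = u∂X»
(row 053 `U49_3`, `U49_4`); consumers (83)(2) p.55 L3–L7 (row 061 `Itm9_9_2`), (84)(5) p.55, p.58 L7 «⊟(g,q) ⊂ ℘nega(Ě)» (G6 R50).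

## 2. The obligation `F33` (ONE `def`, data level, §2 below). Deliberately NOT demanded: (a) blanket Diff-stability from non-negative
sources (E-B/E-E collapse — F33 quantifies ONLY over the `H♭`-family applied to heads); (b) the sign `−δ < 0` (row 057 `U51_2`, case
arithmetic — a HYPOTHESIS: membership demanded only WHERE `−δ < 0`); (c) the order claims Rem. 9.9 (1) / 9.10 (1) / 9.11 (3),(8) (GAP
R05); (d) `y ∈ cot(Ě)`, `ord y = 1`, `ord ϵ(0) > q`, g-cleanedness, the standard-expression relation (rows 052–054) — they would only WEAKEN it.

## 3. Derived §9 SLOTS of a candidate and the CONSUMER MAP («consumer decl ↦ binder ↦ how F33 serves it»)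
Instantiate rows 014/060/061's free §9 parameters at a placement: `pTilde := tildeFlat (tilde P)` («℘̃(Ě) with degrees forgotten»,
p.47 L25–L29), `pnega a := tilde P (−a)` (row 014's pieces), `boxminus := boxminusH K p P (tilde P)` (data-level `⊟(g,q)`). Then:
| consumer (tree) | binder | served by |
|---|---|---|
| `Proofs/S09LLUED/Thm9p18d.lean` p475661 :: `PTildeChainClosure(_ours)_of_carriers`, `Thm9_18_1_of_closure`, `Thm9_18_instCotVec_of_closure`, `LLChainData.h_mem_of_boxminus_subset(_ours)` | `hbox : ∀ g a, boxminus g a ⊆ pTilde` | `boxminusH_subset_tildeFlat` (F33) |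
| same | `hsub` (differences) | `sub_mem_tildeFlat` (AddSubgroup; no F33 needed) |
| same | `hroot : a^p ∈ pTilde → a ∈ pTilde` | NOT F33 — F9 `root_closed` (structure field) + degree bookkeeping |
| same | `hL : ∀ q, frakL q ⊆ pTilde` | NOT F33 — F2/O4 `pos_eq` + «𝔏(Ě,q) ⊆ ℘(E,q)»: `mem_tildeFlat_of_mem_pos` |
| row 060c `PTildeChainClosure(_ours)` (R06 `hR06` of `Thm9_18_1_instOurs_of` p470528) · rows 062/062c `Cor919*` `hU54L42(_ours)` | packaged closure · chain EXISTENCE | the four binders above · NOT F33 (Prop. 9.1 / Th. 9.2, GAP R05) |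
| row 061 `LLChainData.IsLLChainAt(_ours)` (40 binders across `Proofs/S09LLUED/*`, `Proofs/S10LLChainMod/*`) | data; ℘̃ enters via (83)(2), (84)(5) | for an `H♭`-built chain: (83)(2)'s ℘̃-membership = `boxminusH_subset_tildeFlat`; ⊟-memberships are provenance |
| row 014 `Boxminus R pnega` (binder `B` of `Prop9_1_of`, `Prop9_1_V_of`, `prop9_1_conclusion_of_mem`; `Thm9_2/9_3` files) | field `total_subset_negaSum` | `boxminusOfF33` CONSTRUCTS the row-014 structure from F33 |
| row 063c `ZeroStepAdmissible(PPow)_ours` (p486393) | `0 ∈ ⊟(g,a)`, `0 ∈ ℘̃` | `zero_mem_tildeFlat`; `zero_mem_boxminusH_of_datum` (provenance) |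
| row 065 / G6 R50 p.58 L7 «⊟(g,q) ⊂ ℘nega(Ě)» (`Rem9_24_1` slot; `Proofs/S09LLUED/Rem924*.lean`) | `hN`-type inclusions | `mem_negaPiece_of_mem_boxminusH` (degree-exact) |
Not reached by design: F1 (transform «in accord with their respective degrees», p.47 L27–L29 — why F33 is DEGREE-EXACT), O5, F10 `PnegaGMem` (R05).
## 4. The page's ROUTE to F33 = res-type-057's piece calculus (`Rem99c` p482140, `Rem910c` p482188, `Rem911c` p482061): §5
`F33_of_pieces`: **F6c ∧ F2 ∧ (blanket `∂`-stability from every source degree — the E-B shape V3 does NOT carry) ∧ (positive part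
kept) ⇒ F33.** Contrapositively (the scoring content of F3.3): a candidate that fails F33 breaks `O`-stability, the product rule, or
`∂`-stability across the boundary for the `H♭`-operators — one of which an honest candidate MUST break (res-adj-1 E-B/E-E, 087's squeeze).
HONEST FRAMING. Nothing here is a statement of H. Hironaka's manuscript *Resolution of singularities in positive characteristics*
(2017-03-23, [Hironaka2017], lit key `paper:url-3343fd9e678b`; every printed item is a CANDIDATE [claim: Hironaka2017, status:
under-review]). `F33` is OURS: a scoring OBLIGATION a replacement candidate for `℘̃` must meet so that the §9 consumers of the slot
«`⊟(g,q) ⊂ ⊟(Ě) ⊂ ℘nega(Ě) ⊂ ℘̃(Ě)`» can be served; asserted of no candidate. AI typing / AI kernel work, weaker than expert review;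
nothing here is progress on resolution of singularities in positive characteristic; no claim beyond the kernel.
-/

noncomputable section

set_option linter.dupNamespace false -- mandated namespace of this single-conjunct summit

namespace Summit.ResolutionOfSingularities.ResolutionOfSingularities.Theorems.Campaign.PnegaObligation

open Literature.AlgebraicGeometry.Resolution
open Literature.AlgebraicGeometry.Hironaka2017
open Literature.AlgebraicGeometry.Hironaka2017.S09LLUED

universe u v

/-! ## §2 The obligation -/

/-- [OURS · L1 G1 ℘nega-INTERFACE · obligation F3.3 «§9.3 ⊟(g,q) ⊂ ℘̃», DATA LEVEL] replaces the role of the §9 slot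
hypotheses «`⊟(g,a) ⊆ ℘̃(Ě)`» / «`⊟(Ě) ⊂ ℘nega(Ě)`» (p.47 L1–L2, L7–L11; (83)(2) p.55 L3–L7; p.58 L7) for a CANDIDATE family
`tilde`: at every placement `B`, for every guarded ℘-filtration `P` (`Campaign.IsCharFiltration K P`, V3's standing guard C2), every family
`D` of elementary differential operators (`D X` is a `K`-differential operator of order `≤ |X|` and is `ρ^ℓ(B)`-linear — p.49
L17–L20, row 053 `U49_3`/`U49_4`), every leading unit `u₀ ∈ ρ^ℓ(B)` (p.49 L11–L12), monomial base `x`, exponent `q = p^e`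
(`e > 0`), top exponents `α β γ₀` in a case `c` of Lem. 9.6 (row 057 `HFlat.Case`), and every presentation
`g(0) = y^q + ϵ(0) ∈ P q` with `∂ϵ(0) = ∂g(0)` for the two operators used (row 057 `U51_1`, p.51 L10–L11), the
differentiation-product `H♭(ϵ(0))` (row 057 `HFlat.op`, Def. 9.12 p.51) lies in the candidate's piece of the degree the page names
(`HFlat.negDelta`: Rem. 9.9 (2) L7, 9.10 (2) L15, 9.11 (8) L29) whenever that degree is negative (`U51_2` «homogeneity degrees
< 0» taken as hypothesis) — i.e. row 057's `U51_2` membership conjunct at `pw := (tilde P ·)`, restricted to the negative pieces. The F3 CROSSING instance of PNEGA-INTERFACE v0.4 C1 for §9 (sources in the positive degree `q`, values in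
negative degrees), restricted to the `H♭`-family; NOT the blanket positive-source Diff-stability (E-B/E-E collapse). NOT a
statement of the manuscript. VACUITY: met by the candidate `fun _ _ => ⊤`; fails for the «⊥-bypass» of the v0.4 draft as soon as
one `H♭`-value is non-zero — so it is a genuine demand. [folklore] -/
def F33 (K : Type u) [CommRing K] (p : ℕ)
    (tilde : ∀ {B : Type v} [CommRing B] [Algebra K B], (ℕ → Ideal B) → ℤ → AddSubgroup B) : Prop :=
  ∀ {B : Type v} [CommRing B] [Algebra K B] (P : ℕ → Ideal B),
    IsCharFiltration K P →
    ∀ {n : ℕ} (x : Fin n → B) (D : (Fin n →₀ ℕ) → B → B) (ℓ : ℕ),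
      (∀ X : Fin n →₀ ℕ, ∃ L : B →ₗ[K] B, IsDiffOpLE K X.degree L ∧ ∀ f : B, L f = D X f) →
      (∀ (X : Fin n →₀ ℕ) (v f : B), D X (v ^ p ^ ℓ * f) = v ^ p ^ ℓ * D X f) →
    ∀ (u₀ : Bˣ), (∃ v : B, v ^ p ^ ℓ = (u₀ : B)) →
    ∀ (q : ℕ) (α β γ₀ : Fin n →₀ ℕ) (c : HFlat.Case p q α β γ₀) (y ε0 : B),
      (∃ e : ℕ, 0 < e ∧ q = p ^ e) →
      y ^ q + ε0 ∈ P q →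
      D (α + p • β) ε0 = D (α + p • β) (y ^ q + ε0) →
      D (q • γ₀) ε0 = D (q • γ₀) (y ^ q + ε0) →
      HFlat.negDelta p q α β γ₀ c < 0 →
        HFlat.op x D u₀ p q α β γ₀ c ε0 ∈ tilde P (HFlat.negDelta p q α β γ₀ c)

/-! ## §3 Derived slots of a candidate at one placement and the consumer-map kernels — over bare data `N : ℤ → AddSubgroup B`
(instantiate `N := tilde P`); no checklist structure. -/

section Slots

variable {B : Type v} [CommRing B]

/-- «℘̃(Ě) with degrees forgotten» (p.47 L25–L29 «ignoring their degrees and taking the sum as elements of O_ξ»): the additive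
subgroup generated by all pieces — the value to put in the §9 slot `pTilde : Set O` of rows 060/061. [folklore] -/
def tildeFlat (N : ℤ → AddSubgroup B) : AddSubgroup B := ⨆ i : ℤ, N i

/-- `℘nega(Ě)` with degrees forgotten: the additive subgroup generated by the negative pieces `N (−a)`, `a > 0` (row 014's
`negaSum` as a subgroup; see `negaSum_subset_negaFlat` / `mem_negaSum_of_mem_negaPiece`). [folklore] -/
def negaFlat (N : ℤ → AddSubgroup B) : AddSubgroup B := ⨆ a : {a : ℕ // 0 < a}, N (-((a : ℕ) : ℤ))

/-- Row 014's `ℕ`-indexed negative pieces `pnega a = ℘nega(E,−a)` read off the candidate. [folklore] -/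
def negaPieces (N : ℤ → AddSubgroup B) : ℕ → Set B := fun a => (N (-(a : ℤ)) : Set B)

/-- Each piece lies in the flattening. [folklore] -/
theorem le_tildeFlat (N : ℤ → AddSubgroup B) (i : ℤ) : N i ≤ tildeFlat N := le_iSup N i

/-- Membership form of `le_tildeFlat`. [folklore] -/
theorem mem_tildeFlat_of_mem {N : ℤ → AddSubgroup B} {i : ℤ} {f : B} (hf : f ∈ N i) : f ∈ tildeFlat N :=
  le_tildeFlat N i hf

/-- binder `hsub` of `PTildeChainClosure(_ours)_of_carriers` etc.: automatic for an AddSubgroup-valued flattening. [folklore] -/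
theorem sub_mem_tildeFlat (N : ℤ → AddSubgroup B) :
    ∀ a b : B, a ∈ (tildeFlat N : Set B) → b ∈ (tildeFlat N : Set B) → a - b ∈ (tildeFlat N : Set B) :=
  fun _ _ ha hb => (tildeFlat N).sub_mem ha hb

/-- binder `C:pTilde∋0` / `ZeroStepAdmissible_ours` middle clause at the flattened slot. [folklore] -/
theorem zero_mem_tildeFlat (N : ℤ → AddSubgroup B) : (0 : B) ∈ (tildeFlat N : Set B) := (tildeFlat N).zero_mem

/-- The flattened `℘nega` lies in the flattened `℘̃`. [folklore] -/
theorem negaFlat_le_tildeFlat (N : ℤ → AddSubgroup B) : negaFlat N ≤ tildeFlat N :=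
  iSup_le fun _ => le_tildeFlat N _

/-- Each negative piece lies in the flattened `℘nega`. [folklore] -/
theorem le_negaFlat (N : ℤ → AddSubgroup B) {a : ℕ} (ha : 0 < a) : N (-(a : ℤ)) ≤ negaFlat N :=
  le_iSup (fun a : {a : ℕ // 0 < a} => N (-((a : ℕ) : ℤ))) ⟨a, ha⟩

/-- binder `hL`-type service for POSITIVE pieces: if the candidate keeps the positive part (`P q ≤ tilde P q`, F2/O4 `pos_eq`), every
element of `P q` — in particular every LL-head of degree `q`, `U51_1` (a) — lies in the flattened slot. [folklore] -/
theorem mem_tildeFlat_of_mem_pos (N : ℤ → AddSubgroup B) {P : ℕ → Ideal B} {q : ℕ}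
    (hpos : (P q).toAddSubgroup ≤ N (q : ℤ)) {g : B} (hg : g ∈ P q) : g ∈ (tildeFlat N : Set B) :=
  mem_tildeFlat_of_mem (hpos hg)

/-- A single negative-degree element is a `negaSum` (row 014, p.47 L25–L29) of the candidate's pieces. [folklore] -/
theorem mem_negaSum_of_mem_negaPiece (N : ℤ → AddSubgroup B) {a : ℕ} (ha : 0 < a) {h : B}
    (hh : h ∈ N (-(a : ℤ))) : h ∈ negaSum B (negaPieces N) := by
  refine ⟨{a}, fun _ => h, ?_, by simp⟩
  intro b hb
  rw [Finset.mem_singleton] at hb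
  subst hb
  exact ⟨ha, hh⟩

/-- Row 014's `negaSum` of the candidate's pieces sits inside the flattened `℘nega`. [folklore] -/
theorem negaSum_subset_negaFlat (N : ℤ → AddSubgroup B) : negaSum B (negaPieces N) ⊆ (negaFlat N : Set B) := by
  rintro h ⟨s, f, hf, rfl⟩
  refine sum_mem fun a ha => ?_
  obtain ⟨ha0, hfa⟩ := hf a ha
  exact le_negaFlat N ha0 hfa

end Slots

section Boxminus

variable (K : Type u) [CommRing K] (p : ℕ) {B : Type v} [CommRing B] [Algebra K B]
  (P : ℕ → Ideal B) (N : ℤ → AddSubgroup B)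

/-- The DATA-LEVEL `⊟(g,q)` of a candidate at one placement (p.47 L7–L11 «The products of those diff-product operations will fill
up the set ⊟(g,q)»): the set of values `H♭(ϵ(0))` (row 057 `HFlat.op`) over all `F33`-admissible data presenting `g = y^q + ϵ(0)`
in degree `q` (`g ∈ P q`, `∂ϵ(0) = ∂g(0)` for the two operators, `u₀ ∈ ρ^ℓ(B)`, `D` a `ρ^ℓ`-linear family of differential
operators) whose page-degree is NEGATIVE (`U51_2` third conjunct «homogeneity degrees < 0», p.51 L31–L32 — RECORDED as data,
not demanded of the candidate). OURS bookkeeping; not the manuscript's definition (none is printed at this point: row 014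
«EXISTENCE / CONSTRUCTION NOT SHOWN IN PRINT»). [folklore] -/
def boxminusH : B → ℕ → Set B := fun g q =>
  {h | ∃ (n : ℕ) (x : Fin n → B) (D : (Fin n →₀ ℕ) → B → B) (ℓ : ℕ) (u₀ : Bˣ) (α β γ₀ : Fin n →₀ ℕ)
      (c : HFlat.Case p q α β γ₀) (y ε0 : B),
      (∀ X : Fin n →₀ ℕ, ∃ L : B →ₗ[K] B, IsDiffOpLE K X.degree L ∧ ∀ f : B, L f = D X f) ∧
      (∀ (X : Fin n →₀ ℕ) (v f : B), D X (v ^ p ^ ℓ * f) = v ^ p ^ ℓ * D X f) ∧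
      (∃ v : B, v ^ p ^ ℓ = (u₀ : B)) ∧ (∃ e : ℕ, 0 < e ∧ q = p ^ e) ∧
      g = y ^ q + ε0 ∧ g ∈ P q ∧
      D (α + p • β) ε0 = D (α + p • β) g ∧ D (q • γ₀) ε0 = D (q • γ₀) g ∧
      HFlat.negDelta p q α β γ₀ c < 0 ∧
      h = HFlat.op x D u₀ p q α β γ₀ c ε0}

variable {K p P}

/-- **F33 ⇒ every `⊟`-value lies in the candidate's piece of its (negative) page-degree.** [folklore] -/
theorem mem_piece_of_mem_boxminusH
    {tilde : ∀ {B : Type v} [CommRing B] [Algebra K B], (ℕ → Ideal B) → ℤ → AddSubgroup B}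
    (hF : F33 K p tilde)
    (hP : IsCharFiltration K P)
    {g : B} {q : ℕ} {h : B} (hh : h ∈ boxminusH K p P g q) :
    ∃ d : ℤ, d < 0 ∧ h ∈ tilde P d := by
  obtain ⟨n, x, D, ℓ, u₀, α, β, γ₀, c, y, ε0, hD, hDρ, hu, hq, hg, hgP, h1, h2, hneg, rfl⟩ := hh
  subst hg
  exact ⟨_, hneg, hF P hP x D ℓ hD hDρ u₀ hu q α β γ₀ c y ε0 hq hgP h1 h2 hneg⟩

/-- **F33 ⇒ `⊟(g,q) ⊆ ℘nega(Ě)` degree by degree** (p.47 L2, p.58 L7): each value lies in a piece `tilde P (−a)`, `a > 0`.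
[folklore] -/
theorem mem_negaPiece_of_mem_boxminusH
    {tilde : ∀ {B : Type v} [CommRing B] [Algebra K B], (ℕ → Ideal B) → ℤ → AddSubgroup B}
    (hF : F33 K p tilde)
    (hP : IsCharFiltration K P)
    {g : B} {q : ℕ} {h : B} (hh : h ∈ boxminusH K p P g q) :
    ∃ a : ℕ, 0 < a ∧ h ∈ tilde P (-(a : ℤ)) := by
  obtain ⟨d, hd, hmem⟩ := mem_piece_of_mem_boxminusH hF hP hh
  refine ⟨d.natAbs, by omega, ?_⟩
  have : (-(d.natAbs : ℤ)) = d := by omega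
  rw [this]
  exact hmem

/-- **The S09 slot binder `hbox : ∀ g a, boxminus g a ⊆ pTilde`** (`Proofs/S09LLUED/Thm9p18d.lean` ::
`PTildeChainClosure(_ours)_of_carriers`, `Thm9_18_1_of_closure`, `Thm9_18_instCotVec_of_closure`,
`LLChainData.h_mem_of_boxminus_subset(_ours)`; (83)(2)'s «… ∩ ℘̃(Ě)») at the candidate's instantiation
`boxminus := boxminusH`, `pTilde := tildeFlat (tilde P)` — from F33. [folklore] -/
theorem boxminusH_subset_tildeFlat
    {tilde : ∀ {B : Type v} [CommRing B] [Algebra K B], (ℕ → Ideal B) → ℤ → AddSubgroup B}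
    (hF : F33 K p tilde)
    (hP : IsCharFiltration K P) :
    ∀ (g : B) (q : ℕ), boxminusH K p P g q ⊆ (tildeFlat (tilde P) : Set B) := by
  intro g q h hh
  obtain ⟨d, -, hmem⟩ := mem_piece_of_mem_boxminusH hF hP hh
  exact mem_tildeFlat_of_mem hmem

/-- … and inside the flattened `℘nega` (p.47 L2 «⊟(Ě) ⊂ ℘nega(Ě)»). [folklore] -/
theorem boxminusH_subset_negaFlat
    {tilde : ∀ {B : Type v} [CommRing B] [Algebra K B], (ℕ → Ideal B) → ℤ → AddSubgroup B}
    (hF : F33 K p tilde)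
    (hP : IsCharFiltration K P) :
    ∀ (g : B) (q : ℕ), boxminusH K p P g q ⊆ (negaFlat (tilde P) : Set B) := by
  intro g q h hh
  obtain ⟨a, ha, hmem⟩ := mem_negaPiece_of_mem_boxminusH hF hP hh
  exact le_negaFlat (tilde P) ha hmem

/-- **F33 ⇒ row 014's field `total_subset_negaSum`** («⊟(Ě) ⊂ ℘nega(Ě)», p.47 L2) for `⊟(Ě) := ⋃_{g,q} ⊟(g,q)`.
[folklore] -/
theorem boxminusH_subset_negaSum
    {tilde : ∀ {B : Type v} [CommRing B] [Algebra K B], (ℕ → Ideal B) → ℤ → AddSubgroup B}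
    (hF : F33 K p tilde)
    (hP : IsCharFiltration K P) :
    ∀ (g : B) (q : ℕ), boxminusH K p P g q ⊆ negaSum B (negaPieces (tilde P)) := by
  intro g q h hh
  obtain ⟨a, ha, hmem⟩ := mem_negaPiece_of_mem_boxminusH hF hP hh
  exact mem_negaSum_of_mem_negaPiece (tilde P) ha hmem

/-- **F33 ⇒ the row-014 STRUCTURE `Boxminus` of §9** (p.46 L36–p.47 L11; binder `B` of `Prop9_1_of` / `Prop9_1_V_of` /
`prop9_1_conclusion_of_mem`, `Proofs/S09LLUED/Prop91.lean`) instantiated from the candidate: `total := ⋃ ⊟(g,q)`,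
`ofHead := boxminusH`. Its CONTENT field «⊟(Ě) ⊂ ℘nega(Ě)» is discharged by F33; the inclusion `⊟(g,q) ⊆ ⊟(Ě)` is by
construction. (That the so-built `⊟(g,q)` CONTAINS an `h` solving Prop. 9.1 is GAP R05, not F33.) [folklore] -/
def boxminusOfF33
    {tilde : ∀ {B : Type v} [CommRing B] [Algebra K B], (ℕ → Ideal B) → ℤ → AddSubgroup B}
    (hF : F33 K p tilde)
    (hP : IsCharFiltration K P) :
    Boxminus B (negaPieces (tilde P)) where
  total := ⋃ g : B, ⋃ q : ℕ, boxminusH K p P g q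
  total_subset_negaSum := by
    intro h hh
    simp only [Set.mem_iUnion] at hh
    obtain ⟨g, q, hh⟩ := hh
    exact boxminusH_subset_negaSum hF hP g q hh
  ofHead := boxminusH K p P
  ofHead_subset_total := fun g q h hh => Set.mem_iUnion.2 ⟨g, Set.mem_iUnion.2 ⟨q, hh⟩⟩

/-- PROVENANCE (not F33): `0 ∈ ⊟(g,q)` at the data-level slot whenever `g` has an admissible presentation with `ϵ(0) = 0`
(a p-powered head `g = y^q`, the printed convention p.55 L21–L22 / row 061 `U55_2`; row 063c `ZeroStepAdmissiblePPow_ours`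
first clause): the three `H♭` formulas vanish at `0` when the operators are additive (`D X 0 = 0`) — Case (III) uses
`Function.iterate_fixed`. Hypotheses = one admissible datum. [folklore] -/
theorem zero_mem_boxminusH_of_datum {g : B} {q : ℕ} {n : ℕ} (x : Fin n → B) (D : (Fin n →₀ ℕ) → B → B) (ℓ : ℕ)
    (u₀ : Bˣ) (α β γ₀ : Fin n →₀ ℕ) (c : HFlat.Case p q α β γ₀) (y : B)
    (hD : ∀ X : Fin n →₀ ℕ, ∃ L : B →ₗ[K] B, IsDiffOpLE K X.degree L ∧ ∀ f : B, L f = D X f)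
    (hDρ : ∀ (X : Fin n →₀ ℕ) (v f : B), D X (v ^ p ^ ℓ * f) = v ^ p ^ ℓ * D X f)
    (hu : ∃ v : B, v ^ p ^ ℓ = (u₀ : B)) (hq : ∃ e : ℕ, 0 < e ∧ q = p ^ e)
    (hg : g = y ^ q) (hgP : g ∈ P q)
    (h1 : D (α + p • β) 0 = D (α + p • β) g) (h2 : D (q • γ₀) 0 = D (q • γ₀) g)
    (hneg : HFlat.negDelta p q α β γ₀ c < 0) :
    (0 : B) ∈ boxminusH K p P g q := by
  have hD0 : ∀ X : Fin n →₀ ℕ, D X 0 = 0 := by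
    intro X
    obtain ⟨L, -, hL⟩ := hD X
    rw [← hL 0, map_zero]
  have hop : HFlat.op x D u₀ p q α β γ₀ c 0 = 0 := by
    cases c with
    | I _ => simp [HFlat.op, HFlat.caseI, hD0]
    | II _ => simp [HFlat.op, HFlat.caseII, hD0]
    | III _ =>
      simp only [HFlat.op, HFlat.caseIII]
      apply Function.iterate_fixed
      simp [HFlat.pre, hD0]
  refine ⟨n, x, D, ℓ, u₀, α, β, γ₀, c, y, 0, hD, hDρ, hu, hq, by rw [hg, add_zero], hgP, h1, h2, hneg, hop.symm⟩

end Boxminus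

/-! ## §4 Regression: the obligation is NOT vacuous — it fails for the «⊥-bypass» shape at any non-zero `H♭`-value, and it
holds for the trivial top candidate (so it is satisfiable). -/

section Regression

variable (K : Type u) [CommRing K] (p : ℕ)

/-- The candidate that puts everything in every piece meets F33 (satisfiability; of course it fails F7b). [folklore] -/
theorem F33_top : F33 K p (fun {B} [CommRing B] [Algebra K B] (_ : ℕ → Ideal B) (_ : ℤ) => (⊤ : AddSubgroup B)) := by
  intro B _ _ P _ n x D ℓ _ _ u₀ _ q α β γ₀ c y ε0 _ _ _ _ _
  exact AddSubgroup.mem_top _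

/-- A candidate that is `⊥` in all negative degrees (the «⊥-bypass» shape of the v0.4 draft) satisfies F33 ONLY IF every
admissible `H♭`-value of negative page-degree vanishes — so F33 is a genuine demand wherever §9 produces one non-zero `h`.
[folklore] -/
theorem F33_forces_zero_of_neg_bot
    (tilde : ∀ {B : Type v} [CommRing B] [Algebra K B], (ℕ → Ideal B) → ℤ → AddSubgroup B)
    (hbot : ∀ {B : Type v} [CommRing B] [Algebra K B] (P : ℕ → Ideal B) (d : ℤ), d < 0 → tilde P d = ⊥)
    (hF : F33 K p tilde) {B : Type v} [CommRing B] [Algebra K B] (P : ℕ → Ideal B)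
    (hP : IsCharFiltration K P)
    {g : B} {q : ℕ} {h : B} (hh : h ∈ boxminusH K p P g q) : h = 0 := by
  obtain ⟨d, hd, hmem⟩ := mem_piece_of_mem_boxminusH hF hP hh
  rw [hbot P d hd] at hmem
  exact (AddSubgroup.mem_bot).1 hmem

end Regression

/-! ## §5 The page's route: piece-level properties ⇒ F33 (res-type-057's kernels `Rem99c` / `Rem910c` / `Rem911c`) -/

section Route

variable (K : Type u) [CommRing K] (p : ℕ)

/-- [OURS · scoring lemma, DATA LEVEL] **F6c ∧ F2 ∧ blanket `∂`-stability ∧ positive part kept ⇒ F33.** If at every guarded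
placement the candidate's pieces are `O`-stable (`hI`, F6c shape), multiply (`hmul`, F2 shape), are stable under every operator
of any admissible `∂`-family with the degree shift `d ↦ d − |θ|` from EVERY source degree (`hD` — the crossing, E-B shape), and
contain the positive part (`hpos`, F2/O4 `pos_eq` shape), then F33 holds: Case (I) by `HFlat.caseI_mem_of_pieces`, Case (II) by
`HFlat.caseII_mem_of_pieces`, Case (III) by `Rem9_11_5_of_pieces` at `k = k̄ ≥ 1` (`HFlat.kBar_pos_of_isCaseIII`) — the page's
own bookkeeping of Rem. 9.9 (2) / 9.10 (2) / 9.11 (4)(5)(8), p.51, as formalised by res-type-057 (p482140 / p482188 / p482061).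
The sign hypothesis, `u₀ ∈ ρ^ℓ`, `ρ^ℓ`-linearity and `q = p^e` of F33 are not even needed on this route. NOT a statement of the
manuscript. VACUITY: the hypotheses are met by the top candidate; by res-adj-1's CHECK (E-B) together with F7b they are met by
NO honest candidate — which is the point of recording the route. [folklore] -/
theorem F33_of_pieces (hp : 0 < p)
    (tilde : ∀ {B : Type v} [CommRing B] [Algebra K B], (ℕ → Ideal B) → ℤ → AddSubgroup B)
    (hroute : ∀ {B : Type v} [CommRing B] [Algebra K B] (P : ℕ → Ideal B),
      IsCharFiltration K P →
      ∀ {n : ℕ} (D : (Fin n →₀ ℕ) → B → B),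
        (∀ X : Fin n →₀ ℕ, ∃ L : B →ₗ[K] B, IsDiffOpLE K X.degree L ∧ ∀ f : B, L f = D X f) →
        (∀ q : ℕ, 0 < q → ((P q : Set B) ⊆ (tilde P (q : ℤ) : Set B))) ∧
        (∀ (d : ℤ) (r a : B), a ∈ (tilde P d : Set B) → r * a ∈ (tilde P d : Set B)) ∧
        (∀ (i j : ℤ) (a b : B), a ∈ (tilde P i : Set B) → b ∈ (tilde P j : Set B) →
          a * b ∈ (tilde P (i + j) : Set B)) ∧
        (∀ (θ : Fin n →₀ ℕ) (d : ℤ) (a : B), a ∈ (tilde P d : Set B) →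
          D θ a ∈ (tilde P (d - (θ.degree : ℤ)) : Set B))) :
    F33 K p tilde := by
  intro B _ _ P hP n x D ℓ hDop hDρ u₀ hu q α β γ₀ c y ε0 hq hg h1 h2 hneg
  obtain ⟨hpos, hI, hmul, hD⟩ := hroute P hP D hDop
  obtain ⟨e, he, rfl⟩ := hq
  have hq0 : 0 < p ^ e := pow_pos hp e
  have hg' : y ^ p ^ e + ε0 ∈ (tilde P ((p ^ e : ℕ) : ℤ) : Set B) := hpos _ hq0 hg
  -- the pieces as sets
  set pw : ℤ → Set B := fun d => (tilde P d : Set B) with hpw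
  have hI' : ∀ (d : ℤ) (r a : B), a ∈ pw d → r * a ∈ pw d := hI
  have hmul' : ∀ (i j : ℤ) (a b : B), a ∈ pw i → b ∈ pw j → a * b ∈ pw (i + j) := hmul
  have hD' : ∀ (θ : Fin n →₀ ℕ) (d : ℤ) (a : B), a ∈ pw d → D θ a ∈ pw (d - (θ.degree : ℤ)) := hD
  show HFlat.op x D u₀ p (p ^ e) α β γ₀ c ε0 ∈ pw (HFlat.negDelta p (p ^ e) α β γ₀ c)
  cases c with
  | I hI0 =>
    exact HFlat.caseI_mem_of_pieces pw D u₀ p (p ^ e) α β γ₀ hI' hmul' hD' hg' h1 h2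
  | II hII =>
    exact HFlat.caseII_mem_of_pieces pw x D p (p ^ e) α β hI' hD' hg' h1
  | III hIII =>
    show HFlat.caseIII D p (p ^ e) α β γ₀ ε0 ∈ pw (HFlat.negDeltaBIII p (p ^ e) α β γ₀)
    unfold HFlat.caseIII HFlat.negDeltaBIII
    exact Rem9_11_5_of_pieces pw D p (p ^ e) α β γ₀ y ε0 hI' hD' hIII ⟨hg', h1, h2⟩ _
      (HFlat.kBar_pos_of_isCaseIII hIII)

end Route

/-! ## §6 Over the checklist of record: `PnegaInterfaceV3.F33` (typer res-L1-type-o2) -/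

end Summit.ResolutionOfSingularities.ResolutionOfSingularities.Theorems.Campaign.PnegaObligation

namespace Summit.ResolutionOfSingularities.ResolutionOfSingularities.Theorems.Campaign.PnegaInterfaceV3

universe u v

variable {K : Type u} [CommRing K] {p : ℕ} {prov : PnegaProvenance.{u, v} K}

/-- [OURS · L1 G1 ℘nega-INTERFACE · obligation F3.3 over V3] replaces the role of the §9 slot hypotheses «`⊟(g,a) ⊆ ℘̃(Ě)`» /
«`⊟(Ě) ⊂ ℘nega(Ě)`» (p.47 L1–L2, L7–L11; (83)(2) p.55 L3–L7; p.58 L7) as a SCORED OBLIGATION on an inhabitant `I` of the checklist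
`PnegaInterfaceV3` (res-D-plan-1 V3 RULING 01:55:32Z C1): `PnegaObligation.F33 K p I.tilde` — the `H♭`-values of negative page-degree
built from heads in `℘(E,q)` lie in the candidate's piece of that degree, at every guarded placement. The consumer map of §3 then
serves the S09 binders (`PnegaObligation.boxminusH_subset_tildeFlat`, `boxminusOfF33`, …) at `I.tilde P`. NOT a structure field,
NOT a statement of the manuscript, asserted of no candidate. VACUITY: genuine — the diagnostic «⊥-bypass» inhabitant meets it only
where every admissible `H♭`-value vanishes (`PnegaObligation.F33_forces_zero_of_neg_bot`); satisfiable at data level (`F33_top`).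
[folklore] -/
def F33 (I : PnegaInterfaceV3 K p prov) : Prop :=
  PnegaObligation.F33 K p I.tilde

/-- Unfolding anchor (by `Iff.rfl`). [folklore] -/
theorem F33_iff (I : PnegaInterfaceV3 K p prov) : I.F33 ↔ PnegaObligation.F33 K p I.tilde :=
  Iff.rfl

end Summit.ResolutionOfSingularities.ResolutionOfSingularities.Theorems.Campaign.PnegaInterfaceV3
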